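import Mathlib
import Summits.Ventures.PercRepro2.Defs
import Summits.Ventures.PercRepro2.Graph
import Summits.Ventures.PercRepro2.OneColourSwitch
import Summits.Ventures.PercRepro2.RegionHubSign
import Summits.Ventures.PercRepro2.SideSwitch

/-!
# The side switch of a closed set (blind cell PercRepro2, p3 g18, 2026-08-27;
`proofs/P3-CPNC.md` §15b, general form)

The side switch of `SideSwitch` (flip every edge touching `C ⊆ (K₂ ∪ M₂) ∖ {r, s}`) exchanges the
sides of `C` as soon as `C` is CLOSED under adjacency inside `U₂ ∖ {r, s}` (`ClosedIn`) — a union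
of connected components of the graph induced on the sided vertices — with no assumption on the
non-marks (`K2_flipTouch_of_closed`, `M2_flipTouch_of_closed`, `sep2_flipTouch_of_closed`).
This is the general form of `K2_flipTouch`; the proofs are the same closedness arguments.
Own work; std axioms.
-/

namespace Summit.Ventures.PercRepro2

namespace SideSwitch

open Finset Classical RegionHub OneColourSwitch

variable {V : Type*} {E : Type*}
variable (ends : E → Sym2 V)

/-- `C` is closed under adjacency inside `S`: an edge from `C` to `S` ends in `C`. -/
def ClosedIn (S C : Set V) : Prop := ∀ e x y, ends e = s(x, y) → x ∈ C → y ∈ S → y ∈ C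

/-- The sided vertices: `(K₂ ∪ M₂) ∖ {r, s}`. -/
def sided (r s : V) (ω : Config E) : Set V :=
  {x | x ∈ K2 ends r s ω ∪ M2 ends r s ω ∧ x ≠ r ∧ x ≠ s}

variable {ends}

/-- An edge leaving the `W`-world is open. -/
lemma open_of_mem_M2_of_not_mem' {r s : V} {ω : Config E} {x y : V} {e : E}
    (hx : x ∈ M2 ends r s ω) (hy : y ∉ M2 ends r s ω) (hends : ends e = s(x, y)) :
    ω e = true := by
  cases h : ω e
  · exact (hy (mem_M2_of_closed hx h hends)).elim
  · rfl

/-- **The side switch of a closed set, `Y`-world**: `K₂(ω ⊕ touches C) = (K₂ ∖ C) ∪ (C ∩ M₂)`. -/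
theorem K2_flipTouch_of_closed {p q r s : V} {ω : Config E} (h : sep2 ends p q r s ω)
    {C : Set V} (hC : C ⊆ K2 ends r s ω ∪ M2 ends r s ω) (hCr : r ∉ C) (hCs : s ∉ C)
    (hcl : ClosedIn ends (sided ends r s ω) C) :
    K2 ends r s (flipTouch ends C ω) = (K2 ends r s ω \ C) ∪ (C ∩ M2 ends r s ω) := by
  set ω' := flipTouch ends C ω with hω'
  have hmem : ∀ {e : E}, e ∈ touches ends C → ω' e = !ω e := fun het => by
    rw [hω', flipTouch_of_mem ends het]
  have hnot : ∀ {e : E}, e ∉ touches ends C → ω' e = ω e := fun hnt => by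
    rw [hω', flipTouch_of_notMem ends hnt]
  -- a vertex of `U₂` reached from `C` by an edge is in `C` or is `r` or `s`
  have hstep : ∀ {e : E} {x y : V}, ends e = s(x, y) → x ∈ C →
      y ∈ K2 ends r s ω ∪ M2 ends r s ω → y ∉ C → y = r ∨ y = s := by
    intro e x y hends hx hy hyC
    by_contra hne
    exact hyC (hcl e x y hends hx ⟨hy, fun h1 => hne (Or.inl h1), fun h2 => hne (Or.inr h2)⟩)
  apply Set.Subset.antisymm
  · have hcl' : ∀ x ∈ (K2 ends r s ω \ C) ∪ (C ∩ M2 ends r s ω), ∀ y,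
        (openGraph ends ω').Adj x y → y ∈ (K2 ends r s ω \ C) ∪ (C ∩ M2 ends r s ω) := by
      intro x hx y hxy
      obtain ⟨_, e, he, hends⟩ := openGraph_adj.1 hxy
      have hyx : ends e = s(y, x) := by rw [hends, Sym2.eq_swap]
      rcases hx with ⟨hxK, hxC⟩ | ⟨hxC, hxM⟩
      · by_cases hyC : y ∈ C
        · have het : e ∈ touches ends C := mem_touches_of_ends hends (Or.inr hyC)
          have he0 : ω e = false := by
            have := hmem het
            rw [he] at this
            simpa using this.symm
          -- `x` is `r` or `s`
          have hxrs : x = r ∨ x = s := hstep hyx hyC (Or.inl hxK) hxC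
          have hxM : x ∈ M2 ends r s ω := by
            rcases hxrs with rfl | rfl
            · exact r_mem_M2 _ _ ω
            · exact s_mem_M2 _ _ ω
          exact Or.inr ⟨hyC, mem_M2_of_closed hxM he0 hends⟩
        · have hnt : e ∉ touches ends C := not_mem_touches_of_ends hends hxC hyC
          have he1 : ω e = true := by rw [← hnot hnt]; exact he
          exact Or.inl ⟨mem_K2_of_open hxK he1 hends, hyC⟩
      · have het : e ∈ touches ends C := mem_touches_of_ends hends (Or.inl hxC)
        have he0 : ω e = false := by
          have := hmem het
          rw [he] at this
          simpa using this.symm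
        have hyM : y ∈ M2 ends r s ω := mem_M2_of_closed hxM he0 hends
        by_cases hyC : y ∈ C
        · exact Or.inr ⟨hyC, hyM⟩
        · by_cases hyK : y ∈ K2 ends r s ω
          · exact Or.inl ⟨hyK, hyC⟩
          · rcases hstep hends hxC (Or.inr hyM) hyC with rfl | rfl
            · exact (hyK (r_mem_K2 _ _ ω)).elim
            · exact (hyK (s_mem_K2 _ _ ω)).elim
    intro x hx
    rcases mem_K2_iff.1 hx with hc | hc
    · exact mem_of_conn_of_closed hcl' (Or.inl ⟨r_mem_K2 r s ω, hCr⟩) hc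
    · exact mem_of_conn_of_closed hcl' (Or.inl ⟨s_mem_K2 r s ω, hCs⟩) hc
  · rintro x (⟨hxK, hxC⟩ | ⟨hxC, hxM⟩)
    · let Z : Set V := {y | y ∈ K2 ends r s ω → (y ∈ K2 ends r s ω' ∨ y ∈ C)}
      have hcl' : ∀ y ∈ Z, ∀ z, (openGraph ends ω).Adj y z → z ∈ Z := by
        intro y hy z hyz hzK
        obtain ⟨_, e, he, hends⟩ := openGraph_adj.1 hyz
        have hyK : y ∈ K2 ends r s ω := mem_K2_of_open hzK he (by rw [hends, Sym2.eq_swap])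
        by_cases hzC : z ∈ C
        · exact Or.inr hzC
        by_cases hyC : y ∈ C
        · rcases hstep hends hyC (Or.inl hzK) hzC with rfl | rfl
          · exact Or.inl (r_mem_K2 _ _ _)
          · exact Or.inl (s_mem_K2 _ _ _)
        rcases hy hyK with hyK' | hyC'
        · have hnt : e ∉ touches ends C := not_mem_touches_of_ends hends hyC hzC
          have he1 : ω' e = true := by rw [hnot hnt]; exact he
          exact Or.inl (mem_K2_of_open hyK' he1 hends)
        · exact (hyC hyC').elim
      have hrZ : r ∈ Z := fun _ => Or.inl (r_mem_K2 _ _ _)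
      have hsZ : s ∈ Z := fun _ => Or.inl (s_mem_K2 _ _ _)
      have hxZ : x ∈ Z := by
        rcases mem_K2_iff.1 hxK with hc | hc
        · exact mem_of_conn_of_closed hcl' hrZ hc
        · exact mem_of_conn_of_closed hcl' hsZ hc
      rcases hxZ hxK with h1 | h1
      · exact h1
      · exact (hxC h1).elim
    · -- `C ∩ M₂ ⊆ K₂(ω')`: the closed path from `r` or `s` into `C` becomes open
      let Z : Set V := {y | y ∈ M2 ends r s ω → y ∈ C → y ∈ K2 ends r s ω'}
      have hcl' : ∀ y ∈ Z, ∀ z, (openGraph ends (OneColourSwitch.compl ω)).Adj y z → z ∈ Z := by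
        intro y hy z hyz hzM hzC
        obtain ⟨_, e, he, hends⟩ := openGraph_adj.1 hyz
        have he0 : ω e = false := by simpa [OneColourSwitch.compl] using he
        have hzy : ends e = s(z, y) := by rw [hends, Sym2.eq_swap]
        have hyM : y ∈ M2 ends r s ω := mem_M2_of_closed hzM he0 hzy
        have het : e ∈ touches ends C := mem_touches_of_ends hends (Or.inr hzC)
        have he1 : ω' e = true := by rw [hmem het, he0]; rfl
        have key : y ∈ K2 ends r s ω' → z ∈ K2 ends r s ω' := fun hy' =>
          mem_K2_of_open hy' he1 hends
        by_cases hyC : y ∈ C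
        · exact key (hy hyM hyC)
        · rcases hstep hzy hzC (Or.inr hyM) hyC with rfl | rfl
          · exact key (r_mem_K2 _ _ _)
          · exact key (s_mem_K2 _ _ _)
      have hrZ : r ∈ Z := fun _ hr => (hCr hr).elim
      have hsZ : s ∈ Z := fun _ hs => (hCs hs).elim
      have hxZ : x ∈ Z := by
        rcases mem_M2_iff.1 hxM with hc | hc
        · exact mem_of_conn_of_closed hcl' hrZ hc
        · exact mem_of_conn_of_closed hcl' hsZ hc
      exact hxZ hxM hxC

/-- The sided set is invariant under the colour flip. -/
lemma sided_compl (r s : V) (ω : Config E) :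
    sided ends r s (OneColourSwitch.compl ω) = sided ends r s ω := by
  ext x
  simp only [sided, K2_compl, M2_compl, Set.mem_setOf_eq, Set.mem_union]
  constructor
  · rintro ⟨h, hr, hs⟩; exact ⟨h.symm, hr, hs⟩
  · rintro ⟨h, hr, hs⟩; exact ⟨h.symm, hr, hs⟩

/-- **The side switch of a closed set, `W`-world**: `M₂(ω ⊕ touches C) = (M₂ ∖ C) ∪ (C ∩ K₂)`. -/
theorem M2_flipTouch_of_closed {p q r s : V} {ω : Config E} (h : sep2 ends p q r s ω)
    {C : Set V} (hC : C ⊆ K2 ends r s ω ∪ M2 ends r s ω) (hCr : r ∉ C) (hCs : s ∉ C)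
    (hcl : ClosedIn ends (sided ends r s ω) C) :
    M2 ends r s (flipTouch ends C ω) = (M2 ends r s ω \ C) ∪ (C ∩ K2 ends r s ω) := by
  rw [M2, ← K2, compl_flipTouch]
  have hC' : C ⊆ K2 ends r s (OneColourSwitch.compl ω) ∪ M2 ends r s (OneColourSwitch.compl ω) := by
    rw [K2_compl, M2_compl]; exact fun x hx => (hC hx).symm
  have hcl' : ClosedIn ends (sided ends r s (OneColourSwitch.compl ω)) C := by
    rw [sided_compl]; exact hcl
  rw [K2_flipTouch_of_closed (sep2_compl.2 h) hC' hCr hCs hcl', K2_compl, M2_compl]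

/-- The side switch of a closed set preserves `Sep`. -/
theorem sep2_flipTouch_of_closed {p q r s : V} {ω : Config E} (h : sep2 ends p q r s ω)
    {C : Set V} (hC : C ⊆ K2 ends r s ω ∪ M2 ends r s ω) (hCr : r ∉ C) (hCs : s ∉ C)
    (hcl : ClosedIn ends (sided ends r s ω) C) : sep2 ends p q r s (flipTouch ends C ω) := by
  have hK := K2_flipTouch_of_closed h hC hCr hCs hcl
  have hM := M2_flipTouch_of_closed h hC hCr hCs hcl
  obtain ⟨⟨hpK, hqK⟩, ⟨hpM, hqM⟩⟩ := sep2_iff.1 h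
  have hpC : p ∉ C := fun hp => by
    rcases hC hp with h' | h'
    · exact hpK h'
    · exact hpM h'
  have hqC : q ∉ C := fun hq => by
    rcases hC hq with h' | h'
    · exact hqK h'
    · exact hqM h'
  rw [sep2_iff, hK, hM]
  refine ⟨⟨?_, ?_⟩, ⟨?_, ?_⟩⟩
  · rintro (⟨h', _⟩ | ⟨h', _⟩)
    · exact hpK h'
    · exact hpC h'
  · rintro (⟨h', _⟩ | ⟨h', _⟩)
    · exact hqK h'
    · exact hqC h'
  · rintro (⟨h', _⟩ | ⟨h', _⟩)
    · exact hpM h'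
    · exact hpC h'
  · rintro (⟨h', _⟩ | ⟨h', _⟩)
    · exact hqM h'
    · exact hqC h'

/-- `U₂` is preserved by the side switch of a closed set. -/
lemma U2_flipTouch_of_closed {p q r s : V} {ω : Config E} (h : sep2 ends p q r s ω)
    {C : Set V} (hC : C ⊆ K2 ends r s ω ∪ M2 ends r s ω) (hCr : r ∉ C) (hCs : s ∉ C)
    (hcl : ClosedIn ends (sided ends r s ω) C) :
    K2 ends r s (flipTouch ends C ω) ∪ M2 ends r s (flipTouch ends C ω) =
      K2 ends r s ω ∪ M2 ends r s ω := by
  rw [K2_flipTouch_of_closed h hC hCr hCs hcl, M2_flipTouch_of_closed h hC hCr hCs hcl]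
  ext x
  constructor
  · rintro ((⟨hx, _⟩ | ⟨_, hx⟩) | (⟨hx, _⟩ | ⟨_, hx⟩))
    · exact Or.inl hx
    · exact Or.inr hx
    · exact Or.inr hx
    · exact Or.inl hx
  · intro hx
    by_cases hxC : x ∈ C
    · rcases hx with hx | hx
      · exact Or.inr (Or.inr ⟨hxC, hx⟩)
      · exact Or.inl (Or.inr ⟨hxC, hx⟩)
    · rcases hx with hx | hx
      · exact Or.inl (Or.inl ⟨hx, hxC⟩)
      · exact Or.inr (Or.inl ⟨hx, hxC⟩)

/-- The sided set is preserved by the side switch of a closed set. -/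
lemma sided_flipTouch_of_closed {p q r s : V} {ω : Config E} (h : sep2 ends p q r s ω)
    {C : Set V} (hC : C ⊆ K2 ends r s ω ∪ M2 ends r s ω) (hCr : r ∉ C) (hCs : s ∉ C)
    (hcl : ClosedIn ends (sided ends r s ω) C) :
    sided ends r s (flipTouch ends C ω) = sided ends r s ω := by
  ext x
  simp only [sided, Set.mem_setOf_eq]
  rw [U2_flipTouch_of_closed h hC hCr hCs hcl]

end SideSwitch

end Summit.Ventures.PercRepro2
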